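import Summits.AnomalousDissipation.AnomalousDissipation.Theses.KolmogorovLiouville

/-!
# Birth skeleton (BC3) — crux `KolmogorovLiouville.DeepSubBallisticFrames` (stmt-AnomalousDissipation-3020)

Route `AnomalousDissipation/KolmogorovLiouville` (negative side: `closes : … → ¬ AnomalousDissipation`),
item stmt-AnomalousDissipation-3020, crux rank 4, "the physical bet" (A) of the thesis A ∧ B ∧ C:
EVERY zeroth-law family — the clauses of `Literature.Turb.ZerothLaw` verbatim: a smooth divergence-free
mean-zero steady force `f` on `T³`, viscosities `ν_j > 0`, `ν_j → 0`, global Leray–Hopf solutions `u_j`,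
bounded mean energy `sup_j ⟨‖u_j‖²⟩ ≤ E`, mean dissipation `⟨ν_j‖∇u_j‖²⟩ ≥ ε > 0` — admits, for ONE
exponent `h < 1`, constants `M`, `D : ℝ → ℝ` and along a subsequence `φ`, KOLMOGOROV FRAMES
`(t_j, ρ_j, x_j)`: deep (`t_j ≥ 1/ν`), strictly sub-Taylor (`ρ_j²/ν → 0`), with, in local units (length
`ρ_j`, velocity `ν/ρ_j`, time `ρ_j²/ν`), unit oscillation on `Q_1`, sub-ballistic oscillation growth
`∫_{B_R}|v − v̄|² ≤ M R^{3+2h}` for a.e. `|s| ≤ R²`, `1 ≤ R ≤ 1/ρ_j`, and a dissipation profile `≤ D(R)`.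
Skeleton registrar planner-skel-stmt-AnomalousDissipation-3020-0, 2026-08-17 (route re-audit bin
REPAIRABLE; `Cruxes/DeepSubBallisticFrames/` had no workfile before this one).

## The line of this skeleton: GOOD EPOCHS × UNIVERSAL LOCAL STRUCTURE (three registered stubs)

The crux quantifies over a whole FAMILY and concludes with frame clauses that are ESS-SUP in time on
windows of length up to `2/ν_j`, while its hypotheses control only Cesàro means (the gap flagged by both
refuter stamps and the retriage note of the item). The seam below separates exactly three things a proof
must do: SELECT a deep epoch where dissipation happens (from the Cesàro `limsup`), KNOW that the energy is
essentially bounded around it (the ess-sup gap, isolated as its own killable bet), and READ OFF a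
Kolmogorov frame inside such an epoch at ONE viscosity level with LEVEL-INDEPENDENT constants (K41
universality in viscous units — the heart).

* `stub_loudDeepWindows` (window selection; TRUE, size M in Lean). For `ν > 0`, ANY field
  `u : ℝ → T³ → ℝ³` and `0 < ε' ≤ meanDissipation ν u`, beyond every depth `T₀` there is a LOUD window:
  `T ≥ T₀` with `∫⁻_{[T-1,T+1]} ‖∇u(s)‖₂² ds ≥ ε'/ν` (spectral `Torus.eGradNormSq`, the integrand of
  `meanDissipation` and of the Leray–Hopf energy inequality). Proof in print: `meanDissipation` is the real
  `limsup` of the Cesàro means `T⁻¹∫₀ᵀ ν‖∇u‖₂²` (`Turb.longTimeAvgSup`, `timeMean`); the means are `≥ 0`,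
  so `limsup ≥ ε' > 0` is non-junk and the means exceed `3ε'/4` along `T_k → ∞` (there the interval
  integral is non-junk, hence the integrand is integrable on `[0, T_k]`); the part below `a₀ = max T₀ 0 + 1`
  is a fixed finite number, the rest is covered by `≤ (T_k − a₀)/2 + 1` windows of length 2, so the best
  window carries `≥ (3ε'T_k/4 − C)/((T_k − a₀)/2 + 1) → 3ε'/2 > ε'`; convert with
  `ofReal_integral_eq_lintegral_ofReal` + `ENNReal.ofReal_toReal_le` (`lintegral_mono` needs no
  measurability). No Leray–Hopf structure is used. Why it might fail: it should not; the Lean cost is the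
  `Filter.limsup`/`csInf` bookkeeping in `ℝ` (`Real.sInf_empty`, `frequently_lt_of_lt_limsup`) and the
  interval-integral splitting. Sources: DoeringFoias2002 §2 (the averages), Frisch1995 Ch. 5; tree
  `Literature.Analysis.FluidPDE.meanDissipation`, `Turb.longTimeAvgSup`.
* `stub_eventualTameness` (the ess-sup gap as a separately killable BET, size L–XL; "bounded energy
  fluctuations"). Every zeroth-law family (hypotheses of the crux verbatim) has ONE late-time energy level
  `E'` along a subsequence `φ`: for every `j` there is `T₀` with `∫‖u_{φ j}(s)‖² ≤ E'` for a.e. `s ≥ T₀`.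
  Known: at EACH level the absorbing ball gives `limsup_s ‖u(s)‖₂ ≤ ‖f‖₂/(4π²ν)` (energy inequality from
  a.e. `s`, momentum conservation, Poincaré; Foias–Manley–Rosa–Temam 2001 Ch. II–III; DoeringFoias2002 §2),
  a bound `∝ ν⁻²`; the bet is UNIFORMITY in the level for families whose MEAN energy is bounded and whose
  dissipation does not vanish — physically, a statistically steady turbulent flow at fixed force has `O(1)`
  energy fluctuations (an excursion to level `E' ≫ E` needs input `⟨f,u⟩ ≤ ‖f‖‖u‖` to beat dissipation for
  a time `≳ √E'/‖f‖`, i.e. a long relaminarisation at high energy). Why it might fail: rogue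
  relaminarisation bursts — a zeroth-law family whose every level makes arbitrarily late energy excursions
  of level-dependent height (compatible with a bounded Cesàro mean if rare); irrefutable without a
  zeroth-law family, exactly like the crux. NOT an instance of the refuted ceilings 2979/2984/0204 of
  `ledger negatives` (those quantify over ALL Leray–Hopf solutions of a force, laminar `∝ ν⁻²` branches
  included; here the family is a zeroth-law family and `E'` is chosen after it). Fallback reshaping if it
  dies: merge with stub 1 into "tame loud deep windows exist" (tameness only on `[T−1−1/ν, T+1+1/ν]` around
  SOME loud deep `T`, per level of a subsequence) — the composition below uses nothing more.
* `stub_universalKolmogorovFrames` (THE HEART, XL; K41 universality in viscous units, per level). For every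
  smooth divergence-free mean-zero `f` and budgets `E'`, `ε' > 0` there are ONE exponent `h < 1`, constants
  `M`, `D`, a depth-of-scale modulus `ω` with `ω(ν) → 0` as `ν → 0⁺`, and `ν₀ > 0` such that at EVERY level
  `0 < ν < ν₀`, for EVERY global Leray–Hopf solution `u` of `NS_ν(f)` and EVERY deep time `T ≥ 1 + 1/ν`
  whose window is LOUD (`IsLoudWindow ν ε' u T`) and TAME (`IsTameWindow ν E' u T`: `∫‖u(s)‖² ≤ E'` for
  a.e. `s ∈ [T−1−1/ν, T+1+1/ν]`, the union of all frame windows), there is a frame `(t, ρ, x)` with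
  `t ∈ [T−1, T+1]`, `ρ > 0`, `ρ²/ν ≤ ω(ν)`, `x` smooth, satisfying the crux's three clauses VERBATIM at that
  level (`IsKolmogorovFrame h M D ν u t ρ x`). Physics (Frisch1995 §6–8, MeneveauSreenivasan1991): in a loud
  window some point has `ν|∇u|² ≳ ε'`; the local-units oscillation `O(r) = (νr³)⁻¹∫∫_{Q_r}|U−Ū|²` of a
  smooth slice behaves like `|∇U|²r⁴/ν²` as `r → 0`, so `O = 1` is reached at the LOCAL viscous scale
  `r = (ν/|∇U|)^{1/2} ≲ (ν³/ε')^{1/4} = η`, whence `ρ²/ν ≲ (ν/ε')^{1/2} =: ω(ν) → 0` (sub-Taylor); at such a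
  point K41/multifractal scaling gives `∫_{B_R}|v−v̄|² ≲ R^{3+ζ₂}` with `ζ₂/2 ≈ 0.35 < 1` (She–Leveque), the
  `L²`-growth form being insensitive to intermittency, and `D(R) ≈ R⁵`; tameness feeds the top scales
  `R ∼ 1/ρ`. WHY NOT A COSTUME of the crux: (i) it is a ONE-LEVEL, ONE-WINDOW statement — attackable (and
  refutable) at a single small viscosity from a tame loud deep window, with no zeroth-law family and no
  Cesàro means in it; (ii) its constants are universal given `(f, E', ε')` (the crux lets them depend on the
  family); (iii) the ess-sup/Cesàro gap and the epoch selection are NOT in it (stubs 2 and 1). Why it might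
  fail: exactly the crux's failure mode — Couette-type (`h = 1`, laminar shear strictly below the Taylor
  scale) or non-tight deep frames at every loud deep window, the local structure of every PROVED
  ν-dependent-force anomaly (BrueDeLellis2023 Thm 1.1, Cheskidov2023 Thm 1.3); or universality failing
  (constants drifting with the level); for general Leray–Hopf solutions the `ε`-regularity heuristic needs
  suitability (CaffarelliKohnNirenberg1982, Lin1998), unknown for arbitrary Leray–Hopf solutions. Sources:
  Frisch1995 §8.5.5 (`η(h) = ν^{1/(1+h)}`), Kupiainen2010 / BricmontKupiainenLefevere2000 (NS in
  dissipation units `ν = 1`), MeneveauSreenivasan1991, DrivasEyink2019 Lemma 1, the route header.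

Composition `DeepSubBallisticFrames_of` (sorry-free, ~45 lines of honest logic, NOT a one-line seam):
thresholds `T₀ j` from stub 2 (`choose`); universal `(h, M, D, ω, ν₀)` from stub 3 at `(f, E', ε)`;
`ν ∘ φ → 0` (`StrictMono.tendsto_atTop`) gives `N` with `ν_{φ j} < ν₀` for `j ≥ N`
(`Filter.eventually_atTop`, `Iio_mem_nhds`) and the shifted subsequence `φ' j = φ (j + N)` (still
`StrictMono`); per level `φ' j`: a loud window beyond `max (T₀ (j+N)) 0 + 2 + 1/ν` (stub 1 with `ε' = ε`),
which is therefore tame (`Filter.Eventually.mono`) and deep, then a frame from stub 3; `1/ν ≤ t` by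
`linarith`; finally `ρ_j²/ν_{φ' j} → 0` by `squeeze_zero` against `ω (ν (φ' j)) → 0`, obtained from
`Tendsto ω (𝓝[>] 0) (𝓝 0)` and `ν ∘ φ' → 0` inside `(0, ∞)` (`tendsto_nhdsWithin_iff`). The conclusion is
the route decl `KolmogorovLiouville.DeepSubBallisticFrames` BY NAME, its seven frame clauses supplied as
`hρ`, the squeeze, `ht`, `hx` and the three components of `IsKolmogorovFrame` (definitional match with
`(ν ∘ φ') j`, `(u ∘ φ') j s`).

## Disproof / negatives honoured

No `Cruxes/DeepSubBallisticFrames/Disproof.lean` exists (the crux directory had no workfile; `ledger crux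
ls stmt-AnomalousDissipation-3020`, 2026-08-17) — nothing to cite; the item's evidence consists of two
refuter route-review stamps (rc 0; "vacuously TRUE if ¬AnomalousDissipation; unfalsifiable without a
zeroth-law family; ess-sup-in-time window clauses vs Cesàro-mean hypotheses") and one grounder stamp
(verdict NEW). The ess-sup/Cesàro objection is answered structurally: it is stub 2, named and killable on
its own. `ledger negatives --problem AnomalousDissipation` (6 statements, 2026-08-17: 14324 ScalarLift2halfD,
0204 CorrelationEnergyUnboundedNeg, 13037 TaylorCertificatePair, 2979 GPEnergyCeiling, 2984
EnsembleCeilingBridge, 2859 RobustDecayQuantum): none is equal or trivially equivalent to a stub; 2979/2984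
(uniform energy ceilings over ALL solutions of a force) are the nearest in theme to stub 2 and are avoided
as explained above.

## BC3 audit (this seat; raw outputs under `birth-certificate:` in the seat's NOTES.md)

`lean check --json` rc 0, `sorries = 3` = the three `theorem stub_*` (warnings `declaration uses sorry` at
exactly those three declarations, zero elsewhere); audit: `DeepSubBallisticFrames_of` class
`proof.conditional` — "proves Summit.AnomalousDissipation.AnomalousDissipation.Theses.KolmogorovLiouville.
DeepSubBallisticFrames only under unregistered hypotheses [Sig.stub_loudDeepWindows, Sig.stub_eventualTameness,
Sig.stub_universalKolmogorovFrames]"; `DeepSubBallisticFrames_proof` class `proof-of-item` (NOT closed: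
axioms [sorryAx]). Probes (file `bc/DeepSubBallisticFrames_stub_probes.lean` of the seat folder: a copy of
§0–§1 with NO sorried theorem in scope): for each stub, `stub → DeepSubBallisticFrames`,
`stub → AnomalousDissipation` and `stub → ¬AnomalousDissipation` by
`first | exact? | simpa [stub] | (unfold stub; simpa) | aesop` at `maxHeartbeats 400000` — all 9 FAIL
(rc 1, nine `unsolved goals` errors, `aesop: failed to prove the goal after exhaustive search`).

Shape (D-0027 §3.3, as `Cruxes/RelaxingFamily/Lines/birth.lean`): signatures `Sig.stub_<name> : Prop`,
registered stubs `theorem stub_<name> : Sig.stub_<name> := by sorry`, composition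
`DeepSubBallisticFrames_of : Sig.stub_loudDeepWindows → Sig.stub_eventualTameness →
Sig.stub_universalKolmogorovFrames → DeepSubBallisticFrames` (sorry-free) and `DeepSubBallisticFrames_proof`.

References: U. Frisch, *Turbulence* (CUP 1995) Ch. 5, §6–8, §8.5.5 [Frisch1995]; C. Meneveau,
K. R. Sreenivasan, J. Fluid Mech. 224 (1991) 429–484 [MeneveauSreenivasan1991]; C. R. Doering, C. Foias,
J. Fluid Mech. 467 (2002) 289–306 [DoeringFoias2002]; C. Foias, O. Manley, R. Rosa, R. Temam,
*Navier–Stokes Equations and Turbulence* (CUP 2001) Ch. II–III [FoiasManleyRosaTemam2001]; A. Kupiainen,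
"Lessons for turbulence", GAFA 2000 Visions [Kupiainen2010]; J. Bricmont, A. Kupiainen, R. Lefevere,
J. Stat. Phys. 100 (2000) [BricmontKupiainenLefevere2000]; L. Caffarelli, R. Kohn, L. Nirenberg, CPAM 35
(1982) [CaffarelliKohnNirenberg1982]; F. Lin, CPAM 51 (1998) [Lin1998]; E. Bruè, C. De Lellis, CMP 2023
[BrueDeLellis2023]; A. Cheskidov, arXiv:2311.04182 [Cheskidov2023]; T. Drivas, G. Eyink, Nonlinearity 32
(2019) Lemma 1 [DrivasEyink2019].
-/

set_option linter.dupNamespace false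

noncomputable section

namespace Summit.AnomalousDissipation.AnomalousDissipation.Cruxes.DeepSubBallisticFrames.Birth

open MeasureTheory Set Filter Topology
open Summit.AnomalousDissipation.AnomalousDissipation.Theses.KolmogorovLiouville

/-- The flat three-torus (local notation). -/
local notation "𝕋³" => UnitAddTorus (Fin 3)
/-- Velocity values (local notation). -/
local notation "E³" => EuclideanSpace ℝ (Fin 3)

/-! ### §0 Vocabulary of the seam (transparent `def`s over tree declarations) -/

/-- **Loud window.** The length-2 time window centred at `T` carries cumulative (spectral)
enstrophy at least `ε'/ν`, i.e. viscous dissipation `ν ∫_{T-1}^{T+1} ‖∇u‖₂² ≥ ε'`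
(`Torus.eGradNormSq`, the dissipation integrand of `meanDissipation` and of the Leray–Hopf energy
inequality `IsLerayHopfOn.energy_ineq_ae`). -/
def IsLoudWindow (ν ε' : ℝ) (u : ℝ → 𝕋³ → E³) (T : ℝ) : Prop :=
  ENNReal.ofReal (ε' / ν) ≤
    ∫⁻ s in Set.Icc (T - 1) (T + 1), Literature.Analysis.FunctionSpaces.Torus.eGradNormSq (u s)

/-- **Tame window.** On the long window `[T - 1 - 1/ν, T + 1 + 1/ν]` — the union of all frame windows
`[t - R²ρ²/ν, t + R²ρ²/ν]`, `1 ≤ R ≤ 1/ρ`, over frame times `t ∈ [T - 1, T + 1]` — the kinetic energy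
is essentially bounded: `∫ ‖u(s)‖² ≤ E'` for a.e. `s` (the `L^∞_t L²_x` clause of
`IsLerayHopfOn.energy_bound`, but with a LEVEL-INDEPENDENT constant). -/
def IsTameWindow (ν E' : ℝ) (u : ℝ → 𝕋³ → E³) (T : ℝ) : Prop :=
  ∀ᵐ s : ℝ, s ∈ Set.Icc (T - 1 - 1 / ν) (T + 1 + 1 / ν) → ∫⁻ x, ‖u s x‖ₑ ^ 2 ≤ ENNReal.ofReal E'

/-- **Kolmogorov frame at one level** — VERBATIM the three analytic clauses of the crux
(`KolmogorovLiouville.DeepSubBallisticFrames`; equivalently the frame hypotheses of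
`KolmogorovLiouville.KolmogorovBlowup`) for ONE viscosity `ν`, ONE velocity field `u` and ONE frame
`(t, ρ, x)`: in local units (length `ρ`, velocity `ν/ρ`, time `ρ²/ν`) the lifted field has
(i) unit oscillation on the unit parabolic cylinder, (ii) sub-ballistic oscillation growth
`≤ M R^{3+2h}` on `B_R` for a.e. `|s| ≤ R²`, `1 ≤ R ≤ 1/ρ`, (iii) a weak spatial gradient on
`(0, ∞) × ℝ³` with dissipation profile `≤ D(R)` on `Q_R`. -/
def IsKolmogorovFrame (h M : ℝ) (D : ℝ → ℝ) (ν : ℝ) (u : ℝ → 𝕋³ → E³) (t ρ : ℝ) (x : ℝ → E³) :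
    Prop :=
  (ENNReal.ofReal (ν * ρ ^ 3) ≤
      ∫⁻ s in Set.Icc (t - 1 ^ 2 * ρ ^ 2 / ν) (t + 1 ^ 2 * ρ ^ 2 / ν),
        ∫⁻ y in Metric.ball (x s) (1 * ρ),
          ‖Literature.Analysis.FunctionSpaces.Torus.lift (u s) y -
              ⨍ y' in Metric.ball (x s) (1 * ρ), Literature.Analysis.FunctionSpaces.Torus.lift (u s) y'‖ₑ ^ 2) ∧
  (∀ R : ℝ, 1 ≤ R → R * ρ ≤ 1 →
      ∀ᵐ s : ℝ, s ∈ Set.Icc (t - R ^ 2 * ρ ^ 2 / ν) (t + R ^ 2 * ρ ^ 2 / ν) →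
        ∫⁻ y in Metric.ball (x s) (R * ρ),
            ‖Literature.Analysis.FunctionSpaces.Torus.lift (u s) y -
                ⨍ y' in Metric.ball (x s) (R * ρ), Literature.Analysis.FunctionSpaces.Torus.lift (u s) y'‖ₑ ^ 2 ≤
          ENNReal.ofReal (M * R ^ (3 + 2 * h) * ν ^ 2 * ρ)) ∧
  (∃ G : ℝ → E³ → E³ →L[ℝ] E³,
      Literature.Analysis.FluidPDE.HasWeakSpatialGradientOn
          (Literature.Analysis.FluidPDE.slab E³ (Set.Ioi 0) isOpen_Ioi)
          (fun s y => Literature.Analysis.FunctionSpaces.Torus.lift (u s) y) G ∧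
        ∀ R : ℝ, 1 ≤ R → R * ρ ≤ 1 →
          ∫⁻ s in Set.Icc (t - R ^ 2 * ρ ^ 2 / ν) (t + R ^ 2 * ρ ^ 2 / ν),
              ∫⁻ y in Metric.ball (x s) (R * ρ),
                ENNReal.ofReal (Literature.Analysis.FluidPDE.frobeniusNormSq (G s y)) ≤
            ENNReal.ofReal (D R * ν * ρ))

/-! ### §1 Signatures of the registered stubs (by name; D-0027 §3.3 shape) -/

/-- STUB 1 — **LOUD DEEP WINDOWS** (window selection from a Cesàro `limsup`; TRUE, size M in Lean).
For `ν > 0`, any `u`, and `0 < ε' ≤ meanDissipation ν u`, beyond every depth `T₀` some length-2 window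
`[T - 1, T + 1]`, `T ≥ T₀`, carries `∫⁻ ‖∇u‖₂² ≥ ε'/ν` (`IsLoudWindow`). Proof in print in the module
docstring (non-junk `limsup` ⇒ means `> 3ε'/4` along `T_k → ∞` ⇒ integrable integrand ⇒ pigeonhole over
`≤ (T_k − a₀)/2 + 1` windows after discarding the fixed early part; `ofReal ∫ toReal ≤ ∫⁻`). No Leray–Hopf
structure needed. Why it might fail: it should not (real-analysis bookkeeping of `Filter.limsup` in `ℝ`
and interval integrals). Sources: DoeringFoias2002 §2; tree `meanDissipation`, `Turb.longTimeAvgSup`,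
`Turb.timeMean`. -/
def Sig.stub_loudDeepWindows : Prop :=
  ∀ (ν : ℝ) (u : ℝ → 𝕋³ → E³) (ε' : ℝ), 0 < ν → 0 < ε' →
    ε' ≤ Literature.Analysis.FluidPDE.meanDissipation ν u →
      ∀ T₀ : ℝ, ∃ T : ℝ, T₀ ≤ T ∧ IsLoudWindow ν ε' u T

/-- STUB 2 — **EVENTUAL TAMENESS** (uniform late-time energy level along a subsequence; the BET that
isolates the ess-sup/Cesàro gap of the crux; size L–XL). Every zeroth-law family (the crux's hypotheses
verbatim) admits ONE `E'` and a subsequence `φ` such that at every level `φ j` the energy is essentially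
bounded by `E'` after some time `T₀`: `∫ ‖u_{φ j}(s)‖² ≤ E'` for a.e. `s ≥ T₀`. Known per level
(absorbing ball `limsup ‖u‖₂ ≤ ‖f‖₂/(4π²ν)`, a `ν⁻²` bound); the bet is uniformity for bounded-MEAN-energy
dissipating families ("bounded energy fluctuations of statistically steady turbulence"). Why it might
fail: rogue late relaminarisation bursts of level-dependent height at every level (rare enough for a
bounded Cesàro mean); irrefutable without a zeroth-law family. Not an instance of negatives 2979/2984/0204
(those range over ALL solutions of a force, laminar `ν⁻²` branches included). Sources: DoeringFoias2002
§2, FoiasManleyRosaTemam2001 Ch. II–III, Frisch1995 Ch. 5; refuter stamps of item 3020 (the gap). -/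
def Sig.stub_eventualTameness : Prop :=
  ∀ (f : 𝕋³ → E³) (ν : ℕ → ℝ) (u₀ : ℕ → 𝕋³ → E³) (u : ℕ → ℝ → 𝕋³ → E³),
    Literature.Analysis.FunctionSpaces.Torus.IsSmooth f →
    Literature.Analysis.FunctionSpaces.Torus.IsDivFree f →
    Literature.Analysis.FunctionSpaces.Torus.HasZeroMean f →
    (∀ j, 0 < ν j) → Filter.Tendsto ν Filter.atTop (nhds 0) →
    (∀ j, Literature.Analysis.FluidPDE.Torus.IsGlobalLerayHopf (ν j) (fun _ => f) (u₀ j) (u j)) →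
    (∃ E : ℝ, ∀ j, Literature.Analysis.FluidPDE.meanEnergy (u j) ≤ E) →
    (∃ ε : ℝ, 0 < ε ∧ ∀ j, ε ≤ Literature.Analysis.FluidPDE.meanDissipation (ν j) (u j)) →
      ∃ (E' : ℝ) (φ : ℕ → ℕ), StrictMono φ ∧
        ∀ j, ∃ T₀ : ℝ, ∀ᵐ s : ℝ, T₀ ≤ s → ∫⁻ x, ‖u (φ j) s x‖ₑ ^ 2 ≤ ENNReal.ofReal E'

/-- STUB 3 — **UNIVERSAL KOLMOGOROV FRAMES IN TAME LOUD DEEP WINDOWS** (the HEART, XL; K41 universality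
in viscous units, ONE level at a time). For every smooth divergence-free mean-zero `f` and budgets `E'`,
`ε' > 0` there are an exponent `h < 1`, constants `M`, `D`, a modulus `ω → 0` at `0⁺` and `ν₀ > 0` such
that at every level `0 < ν < ν₀`, every global Leray–Hopf solution of `NS_ν(f)` and every deep
`T ≥ 1 + 1/ν` with a LOUD and TAME window has a frame `(t, ρ, x)`, `t ∈ [T-1, T+1]`, `ρ > 0`,
`ρ²/ν ≤ ω(ν)` (strictly sub-Taylor, uniformly in the level), `x` smooth, satisfying the crux's three
clauses verbatim at that level (`IsKolmogorovFrame`). Heuristic: loudness puts `ν|∇u|² ≳ ε'` somewhere in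
the window; local-units oscillation `O(r) ≈ |∇U|²r⁴/ν²` reaches `1` at the local viscous scale
`r ≲ (ν³/ε')^{1/4}`, so `ρ²/ν ≲ (ν/ε')^{1/2}`; K41/multifractal `L²` scaling gives growth `R^{3+ζ₂}`,
`ζ₂/2 ≈ 0.35 < 1`, and `D(R) ≈ R⁵`; tameness controls the top scales. NOT a costume of the crux: one
level, one window, no family, no Cesàro means, universal constants; killable at a single small `ν`. Why
it might fail: Couette-type (`h = 1`, sub-Taylor laminar shear) or non-tight frames at every loud deep
window — the local structure of every proved ν-DEPENDENT-force anomaly (BrueDeLellis2023 Thm 1.1,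
Cheskidov2023 Thm 1.3); universality failing (constants drifting with the level); suitability of general
Leray–Hopf solutions (ε-regularity, CaffarelliKohnNirenberg1982 / Lin1998) unavailable. Sources: Frisch1995
§8.5.5, MeneveauSreenivasan1991, Kupiainen2010, BricmontKupiainenLefevere2000, DrivasEyink2019 Lemma 1,
route header of KolmogorovLiouville. -/
def Sig.stub_universalKolmogorovFrames : Prop :=
  ∀ (f : 𝕋³ → E³),
    Literature.Analysis.FunctionSpaces.Torus.IsSmooth f →
    Literature.Analysis.FunctionSpaces.Torus.IsDivFree f →
    Literature.Analysis.FunctionSpaces.Torus.HasZeroMean f →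
    ∀ (E' ε' : ℝ), 0 < ε' →
      ∃ h : ℝ, h < 1 ∧ ∃ (M : ℝ) (D : ℝ → ℝ) (ω : ℝ → ℝ) (ν₀ : ℝ),
        0 < ν₀ ∧ Filter.Tendsto ω (nhdsWithin 0 (Set.Ioi 0)) (nhds 0) ∧
        ∀ (ν : ℝ) (u₀ : 𝕋³ → E³) (u : ℝ → 𝕋³ → E³) (T : ℝ), 0 < ν → ν < ν₀ →
          Literature.Analysis.FluidPDE.Torus.IsGlobalLerayHopf ν (fun _ => f) u₀ u →
          1 + 1 / ν ≤ T → IsLoudWindow ν ε' u T → IsTameWindow ν E' u T →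
            ∃ (t ρ : ℝ) (x : ℝ → E³), t ∈ Set.Icc (T - 1) (T + 1) ∧ 0 < ρ ∧ ρ ^ 2 / ν ≤ ω ν ∧
              ContDiff ℝ (⊤ : ℕ∞) x ∧ IsKolmogorovFrame h M D ν u t ρ x

/-! ### §2 Registered stubs (the only `sorry`s of the file) -/

/-- Registered stub 1 — loud deep windows (theorem-grade; claimable now). -/
theorem stub_loudDeepWindows : Sig.stub_loudDeepWindows := by
  sorry

/-- Registered stub 2 — eventual tameness (the ess-sup/Cesàro bet). -/
theorem stub_eventualTameness : Sig.stub_eventualTameness := by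
  sorry

/-- Registered stub 3 — universal Kolmogorov frames (the heart; hardest). -/
theorem stub_universalKolmogorovFrames : Sig.stub_universalKolmogorovFrames := by
  sorry

/-! ### §3 Composition (kernel-checked; no `sorry` outside the three stubs) -/

/-- **The skeleton closes the crux BY NAME**: `Sig.stub_loudDeepWindows → Sig.stub_eventualTameness →
Sig.stub_universalKolmogorovFrames → KolmogorovLiouville.DeepSubBallisticFrames`. Tameness thresholds
(stub 2) ⇒ universal constants (stub 3) ⇒ drop the levels with `ν ≥ ν₀` (shifted subsequence
`φ' j = φ (j + N)`) ⇒ per level a loud window beyond the tameness threshold and the depth `2 + 1/ν`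
(stub 1), hence tame and deep ⇒ a frame (stub 3) ⇒ `1/ν ≤ t` by arithmetic and `ρ_j²/ν_{φ' j} → 0` by
squeezing against `ω (ν (φ' j)) → 0`. -/
theorem DeepSubBallisticFrames_of :
    Sig.stub_loudDeepWindows → Sig.stub_eventualTameness → Sig.stub_universalKolmogorovFrames →
      DeepSubBallisticFrames := by
  intro h₁ h₂ h₃ f ν u₀ u hf hdf hmf hν hν0 hLH hE hε
  obtain ⟨ε, hεpos, hεj⟩ := hε
  -- Stub 2: ONE late-time energy level `E'` along a subsequence `φ`, thresholds `T₀ j`.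
  obtain ⟨E', φ, hφ, hT0⟩ := h₂ f ν u₀ u hf hdf hmf hν hν0 hLH hE ⟨ε, hεpos, hεj⟩
  choose T₀ hT₀ using hT0
  -- Stub 3: universal constants `(h, M, D, ω, ν₀)` for the budgets `(f, E', ε)`.
  obtain ⟨h, hh, M, D, ω, ν₀, hν₀, hω, hP⟩ := h₃ f hf hdf hmf E' ε hεpos
  -- Drop the finitely many levels of the subsequence with `ν ≥ ν₀`.
  have hνφ : Tendsto (ν ∘ φ) atTop (𝓝 0) := hν0.comp hφ.tendsto_atTop
  obtain ⟨N, hN⟩ : ∃ N, ∀ j ≥ N, ν (φ j) < ν₀ :=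
    eventually_atTop.1 (hνφ.eventually (Iio_mem_nhds hν₀))
  set φ' : ℕ → ℕ := fun j => φ (j + N) with hφ'_def
  have hφ' : StrictMono φ' := fun a b hab => hφ (Nat.add_lt_add_right hab N)
  -- Per level: a loud window beyond the tameness threshold (stub 1), then a frame (stub 3).
  have key : ∀ j, ∃ (t ρ : ℝ) (x : ℝ → E³), 0 < ρ ∧ ρ ^ 2 / ν (φ' j) ≤ ω (ν (φ' j)) ∧
      1 / ν (φ' j) ≤ t ∧ ContDiff ℝ (⊤ : ℕ∞) x ∧
      IsKolmogorovFrame h M D (ν (φ' j)) (u (φ' j)) t ρ x := by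
    intro j
    have hνj : 0 < ν (φ' j) := hν _
    have hνj₀ : ν (φ' j) < ν₀ := hN (j + N) (Nat.le_add_left N j)
    obtain ⟨T, hTge, hloud⟩ := h₁ (ν (φ' j)) (u (φ' j)) ε hνj hεpos (hεj _)
      (max (T₀ (j + N)) 0 + 2 + 1 / ν (φ' j))
    have h1ν : (0 : ℝ) < 1 / ν (φ' j) := by positivity
    have hmax0 : (0 : ℝ) ≤ max (T₀ (j + N)) 0 := le_max_right _ _
    have hmaxT : T₀ (j + N) ≤ max (T₀ (j + N)) 0 := le_max_left _ _
    have hdeep : 1 + 1 / ν (φ' j) ≤ T := by linarith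
    have htame : IsTameWindow (ν (φ' j)) E' (u (φ' j)) T := by
      filter_upwards [hT₀ (j + N)] with s hs hsI
      exact hs (by linarith [hsI.1])
    obtain ⟨t, ρ, x, htI, hρ, hρω, hx, hF⟩ :=
      hP (ν (φ' j)) (u₀ (φ' j)) (u (φ' j)) T hνj hνj₀ (hLH _) hdeep hloud htame
    exact ⟨t, ρ, x, hρ, hρω, by linarith [htI.1], hx, hF⟩
  choose t ρ x hρ hρω ht hx hF using key
  refine ⟨h, hh, M, D, φ', hφ', t, ρ, x, hρ, ?_, ht, hx, fun j => (hF j).1, fun j => (hF j).2.1,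
    fun j => (hF j).2.2⟩
  -- `ρ_j² / ν_{φ' j} → 0`: squeeze with `ω (ν (φ' j)) → 0` (`ν ∘ φ' → 0` inside `(0, ∞)`).
  have hνφ' : Tendsto (fun j => ν (φ' j)) atTop (𝓝[>] 0) :=
    tendsto_nhdsWithin_iff.2 ⟨hν0.comp hφ'.tendsto_atTop, Eventually.of_forall fun j => hν _⟩
  exact squeeze_zero (fun j => div_nonneg (sq_nonneg _) (hν _).le) hρω (hω.comp hνφ')

/-- The skeleton in its final shape (D-0027 §3.3): the crux BY NAME from the three registered stubs; it
becomes the crux proof when the last `stub_*` is discharged (until then it depends on `sorryAx` through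
the stubs only — no `sorry` of its own). -/
theorem DeepSubBallisticFrames_proof : DeepSubBallisticFrames :=
  DeepSubBallisticFrames_of stub_loudDeepWindows stub_eventualTameness stub_universalKolmogorovFrames

end Summit.AnomalousDissipation.AnomalousDissipation.Cruxes.DeepSubBallisticFrames.Birth

end
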